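import Literature.NumberTheory.EllipticCurves.TateModuleFreeProofs
import Literature.NumberTheory.EllipticCurves.TateModuleProjSurjectiveProofs
import Literature.NumberTheory.EllipticCurves.TateModuleProofs
import Literature.NumberTheory.EllipticCurves.GaloisActionProofs
import Mathlib.LinearAlgebra.Charpoly.BaseChange
import HarnessLib

/-!
# Cayley–Hamilton for one Galois element on the Tate module, read on every torsion level `E[p^j]` (proofs)

`Proofs` file (theorems only; no definition, no named fact, no instance) in topic `NumberTheory/EllipticCurves`.

For an elliptic curve `E = W` over a field `F` with `p ≠ 0` in `F` and ONE element `σ ∈ Γ_F`, the characteristic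
polynomial `X² + a₁ X + a₀ ∈ ℤ_p[X]` of `σ` on the Tate module `T_p E ≅ ℤ_p²` (Silverman *AEC* III.7.1; the tree's
`W.tateModule p`, free of rank two: `module_free_tateModule_holds`, `finrank_tateModule_eq_two_of_card_torsionPoints_eq_sq`)
kills `σ` (Cayley–Hamilton, Mathlib `LinearMap.aeval_self_charpoly`), its constant coefficient `a₀ = det σ` is a UNIT
(`σ` acts invertibly), and — projecting along the surjections `T_p E ↠ E[p^j]` (the tree's
`proj_surjective_of_isAlgClosed_holds`) — the SAME two `p`-adic integers give, at EVERY level `j`,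

  `σ(σP) + (a₁ mod p^j) • σP + (a₀ mod p^j) • P = 0`  for all `P ∈ E[p^j]`

(`WeierstrassCurve.exists_cayleyHamilton_torsion`).  This is the `E`-side input of the cell's (`pub/bsd-print-x9`)
uniform bound on the local invariants `H⁰(K_v, E[p^j] ⊗ A_{m,j}(ψ))` of Howard's Eisenstein levels at a finitely
decomposed place (hypothesis H.4 of [Howard 2004] at `v ∣ N`): one Galois element, one polynomial, all levels.

References: [SilvermanAEC2009] J. H. Silverman, *The Arithmetic of Elliptic Curves*, 2nd ed. (2009), Prop. III.7.1,
III.§7 (the `ℓ`-adic representation), Cor. III.6.4; [SerreAbelianLadic1968] J.-P. Serre, *Abelian ℓ-adic representations*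
(1968), Ch. I §1.1–1.2; [Howard2004HeegnerKolyvagin] B. Howard, Compositio Math. 140 (2004), §1.3 H.4 and §2.2.
BSD is not proved by any of this.
-/

noncomputable section

open Polynomial

universe u

namespace WeierstrassCurve

open Literature Literature.NumberTheory.EllipticCurves

variable {F : Type u} [Field F] (W : WeierstrassCurve F) [W.IsElliptic] (p : ℕ) [hp : Fact p.Prime]

/-- **Cayley–Hamilton for `σ` on `T_p E`, read on every `E[p^j]`.** For an elliptic curve `E = W` over a field `F` with
`p ≠ 0` in `F` and `σ ∈ Γ_F` there are `a₁, a₀ ∈ ℤ_p` with `a₀` a UNIT (indeed `X² + a₁X + a₀` is the characteristic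
polynomial of `σ` on `T_p E ≅ ℤ_p²` and `a₀ = det σ`) such that for every `j` and every `P ∈ E(F̄)` with `p^j P = 0`:
`σ(σP) + (a₁ mod p^j) • σP + (a₀ mod p^j) • P = 0` (`(· mod p^j)` = `PadicInt.toZModPow j`, acting through its value
in `ℕ`).  [cite: SilvermanAEC2009, Prop. III.7.1 and III.§7] [cite: SerreAbelianLadic1968, Ch. I §1.2] -/
theorem exists_cayleyHamilton_torsion (hpF : (p : F) ≠ 0) (σ : Field.absoluteGaloisGroup F) :
    ∃ a₁ a₀ : ℤ_[p], IsUnit a₀ ∧ ∀ (j : ℕ) (P : geomPoints W), ((p : ℤ) ^ j) • P = 0 →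
      σ • (σ • P) + ((PadicInt.toZModPow j a₁).val : ℤ) • (σ • P) + ((PadicInt.toZModPow j a₀).val : ℤ) • P = 0 := by
  -- the Tate module is free of rank two
  haveI : Module.Free ℤ_[p] (W.tateModule p) := module_free_tateModule_holds W p
  haveI : Module.Finite ℤ_[p] (W.tateModule p) := module_finite_tateModule_holds W p
  have hrank : Module.finrank ℤ_[p] (W.tateModule p) = 2 :=
    finrank_tateModule_eq_two_of_card_torsionPoints_eq_sq W p (card_torsionPoints_eq_sq_holds W _) hpF
  -- the endomorphism `σ` and its characteristic polynomial
  set f : W.tateModule p →ₗ[ℤ_[p]] W.tateModule p := galoisRepTate W p σ with hf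
  set Q : ℤ_[p][X] := f.charpoly with hQ
  have hmonic : Q.Monic := f.charpoly_monic
  have hdeg : Q.natDegree = 2 := by rw [hQ, LinearMap.charpoly_natDegree, hrank]
  -- `Q = X² + a₁ X + a₀`
  have hQeq : Q = X ^ 2 + C (Q.coeff 1) * X + C (Q.coeff 0) := by
    have h := hmonic.as_sum
    rw [hdeg] at h
    rw [h]
    simp [Finset.sum_range_succ]
    ring
  refine ⟨Q.coeff 1, Q.coeff 0, ?_, fun j P hP ↦ ?_⟩
  · -- `a₀ = ± det σ` is a unit: `σ` is invertible on `T_p E`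
    have hdet : LinearMap.det f = (-1) ^ Module.finrank ℤ_[p] (W.tateModule p) * Q.coeff 0 :=
      LinearMap.det_eq_sign_charpoly_coeff f
    have hunitf : IsUnit f := by
      rw [hf]
      exact ((galoisRepTate W p).toHomUnits σ).isUnit
    have hunitdet : IsUnit (LinearMap.det f) := hunitf.map LinearMap.det
    rw [hdet] at hunitdet
    exact isUnit_of_mul_isUnit_right hunitdet
  · -- Cayley–Hamilton on `T_p E`, projected to `E[p^j]`
    have hP' : P ∈ geomTorsion W (p ^ j : ℕ) :=
      (Submodule.mem_torsionBy_iff _ _).2 (by rw [Nat.cast_pow]; exact hP)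
    obtain ⟨a, rfl⟩ := proj_surjective_of_isAlgClosed_holds W p j hP'
    have hCH : Polynomial.aeval f Q a = 0 := by
      rw [hQ, LinearMap.aeval_self_charpoly]; rfl
    rw [hQeq] at hCH
    simp only [map_add, map_mul, aeval_X, aeval_C, LinearMap.add_apply, Module.End.mul_apply,
      Module.algebraMap_end_apply, pow_two] at hCH
    -- read the identity `f (f a) + a₁ • f a + a₀ • a = 0` at level `j`
    have h := congrArg (TateModule.proj p j) hCH
    rw [map_add, map_add, map_zero, TateModule.proj_smul, TateModule.proj_smul, hf, galoisRepTate_apply_apply,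
      galoisRepTate_apply_apply, TateModule.proj_smul_of_distribMulAction,
      TateModule.proj_smul_of_distribMulAction] at h
    rw [natCast_zsmul, natCast_zsmul]
    exact h

end WeierstrassCurve

end
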